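import Summits.BirchSwinnertonDyer.BirchSwinnertonDyer.Theorems.RamifiedHeegnerPairGss2LowerAtThreeRankZeroCertificateOfLeaf
import Summits.BirchSwinnertonDyer.BirchSwinnertonDyer.Theorems.RamifiedHeegnerPairLeafRankZeroUpperAtThreePartnerLowerSources
import Summits.BirchSwinnertonDyer.BirchSwinnertonDyer.Theorems.RamifiedHeegnerPairLeafRankOneUpperAtThreePartnerLower
import Summits.BirchSwinnertonDyer.BirchSwinnertonDyer.Theorems.RamifiedHeegnerPairLeafSigmaStarTightAllRows
import HarnessLib

/-!
# Route `RamifiedHeegnerPair` (leaf `WAllExclAddGssAtThree`, W-ALL row 2·3@3) — the column's EXACT RESIDUAL: modulo print, the leaf is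
# EQUIVALENT to the conjunction T1⁻ (A 27200 ∧ A₃ₙₙ ∧ A₀) ∧ Σ★″ 27493 ∧ PL₁|3Nn ∧ PL₀ — a two-sided kernel statement (column v5)

HONEST FRAMING. Theorems only; helper file (`--supports stmt-BirchSwinnertonDyer-26021 --as helper`); nothing is booked, no item is closed,
BSD is not proved for any curve; every research conjunct below is OPEN. Lead prover bsd-line-rhp-p1 g7 (L₁ lead), 2026-08-28. Sequel of the
column assemblies v1–v4 (p631681, p632422, p633075, p635020: ONE-sided, «leaf ⟸ print ∧ residual») and of the tightness files (rhp-p2 g7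
p634493/p634913/p635881: PL ⟸ leaf; rhp-p2 `…LeafSigmaStarTightAllRows`: Σ★″ ⟸ leaf; this lead p638242/p638799: A, A₃ₙₙ, A₀ ⟸ leaf).

THE STATEMENT (`wAllExclAddGssAtThree_iff_exactResidual`). GIVEN the print conjunctions GZK (19921), PUB 27199, PUB⁺ 27491, PUB₀⁺, the
LOWER Matar–Nekovář half (STRUCT) and the Jetchev-reading S2 27492 — all un-discharged named facts of the tree, displayed —
  `WAllExclAddGssAtThree ↔ A ∧ A₃ₙₙ ∧ A₀ ∧ Σ★″ ∧ PL₁|3Nn ∧ PL₀`,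
where A = item 27200 BY NAME (McCallum certificates of adjusted depth on the tower rank-one rows), A₃ₙₙ = the v5 stub text (the same on the `3Nn`
rows, odd frame), A₀ = `hC0` of the column files (the same at the (0, 1)-frames of the rank-zero rows), Σ★″ = item 27493 BY NAME (Jetchev's
Σ-form divisibility, optimal member, off the mono-carrier rows), PL₁|3Nn / PL₀ = rhp-p2's partner-lower supplies VERBATIM (the LOWER half of ONE
Heegner partner: of a rank-one twist of each `3Nn` rank-zero row / of a rank-zero twist of each rank-one row). (⟸) is column v4 with the two
twist-unit inputs replaced by their TIGHT forms PL (U₀|3Nn ⟸ PUB₀⁺ ∧ S2 ∧ Σ★″ ∧ PL₁|3Nn, p634913; U₁ ⟸ PUB⁺ ∧ S2 ∧ Σ★″ ∧ PL₀, p634493; L₁ by the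
v5 composition; L₀ by p631233; U₀ by Kato on the tower rows); (⟹) collects the tightness theorems. So the conjunction is the column's open
content EXACTLY — no surplus, no slack; each conjunct has a per-class instrument (trib-w: KOLY-CERT for A/A₀, TU censuses j308272/j308884 for PL).

References: [cite: MatarNekovar2019, Thm. 0.7 (p. 456) and §0.11 (p. 457)] [cite: McCallumLMS1991, §5 Cor. 5.6 (p. 310)]
[cite: Kato2004Asterisque, Thm. 14.5 (3) (p. 236), Prop. 14.16 (2) (p. 244)] [cite: Jetchev2008, Thm. 1.4, Conj. 1.3]
[cite: CastellaGrossiLeeSkinner2022, proof of Thm. 5.3.1, display (5.6)] [cite: HoffsteinLuo1997, Theorem (§1, pp. 435–436)]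
[cite: BumpFriedbergHoffstein1990, Theorem (p. 543)] [cite: Miller2011LMS, Def. 1.1].
-/

-- D-0017: single-problem summit, so `Summit.BirchSwinnertonDyer.BirchSwinnertonDyer.…` repeats a namespace BY DESIGN.
set_option linter.dupNamespace false
set_option autoImplicit false

noncomputable section

open scoped Classical NumberField

open WeierstrassCurve Literature.NumberTheory.EllipticCurves
  Literature.NumberTheory.EllipticCurves.Rank1Residual
  Literature.NumberTheory.EllipticCurves.Rank1Residual.Typed
  Summit.BirchSwinnertonDyer.Rank1Residual
  Summit.BirchSwinnertonDyer.Rank1Residual.Additive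
  Summit.BirchSwinnertonDyer.BirchSwinnertonDyer.Theorems
  Summit.BirchSwinnertonDyer.BirchSwinnertonDyer.Theses.RamifiedHeegnerPair

namespace Summit.BirchSwinnertonDyer.BirchSwinnertonDyer.Theorems.RamifiedPairLowerBound

/-- **THE Gss2 COLUMN'S EXACT RESIDUAL (v5).** Modulo the displayed print (GZK, PUB 27199, PUB⁺ 27491, PUB₀⁺, the lower Matar–Nekovář half, the
Jetchev reading S2 27492): `WAllExclAddGssAtThree ↔ A 27200 ∧ A₃ₙₙ ∧ A₀ ∧ Σ★″ 27493 ∧ PL₁|3Nn ∧ PL₀`. (⟸): L₁ by the v5 composition with U₀|3Nn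
from PL₁|3Nn (p634913), U₁ from PL₀ (p634493), L₀ by the certificate road (p631233), U₀ by Kato on the tower rows, then `closes`. (⟹): BSD₃ on the
leaf gives the four member halves; A / A₃ₙₙ by `gss2RankOneMcCallumCertificateAtThreeTower_of_members` / `certificates3Nn_of_members` (p638242),
A₀ by `certificatesZero_of_members` (p638799), Σ★″ by rhp-p2's `leafSigmaStarDivisibilityAtThreeOptimalOffRows_of_wAllExclAddGssAtThree`, PL by
rhp-p2's `partnerLower{Zero}_of_wAllExclAddGssAtThree`. Books nothing; every research conjunct is OPEN. [cite: Miller2011LMS, Def. 1.1]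
[cite: MatarNekovar2019, Thm. 0.7 (p. 456) and §0.11 (p. 457)] [cite: Kato2004Asterisque, Thm. 14.5 (3) (p. 236)] [cite: Jetchev2008, Thm. 1.4] -/
theorem wAllExclAddGssAtThree_iff_exactResidual
    (hP : PublishedInputGZK) (hpub : Gss2LowerPrintedInputsAtThree) (hpubU : LeafRankOnePrintedInputsAtThree)
    (hpub0 : (∀ (N : ℕ) [NeZero N] (W : WeierstrassCurve ℚ) (K : Type) [Field K] [NumberField K],
        Literature.NumberTheory.EllipticCurves.gross_zagier N W K) ∧
      (∀ (N : ℕ) [NeZero N] (W : WeierstrassCurve ℚ) (K : Type) [Field K] [NumberField K],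
        Literature.NumberTheory.EllipticCurves.kolyvagin N W K) ∧
      Literature.NumberTheory.EllipticCurves.rank_eq_analyticRank_of_analyticRank_le_one ∧
      WeierstrassCurve.hasEntireLFunction_rat ∧
      Literature.NumberTheory.EllipticCurves.MatarNekovar2019.thm07_padicValNat_card_sha_primary_add_le_of_globalDivisibility_of_irreducible ∧
      Literature.NumberTheory.EllipticCurves.ModularForms.exists_isNewformOf ∧
      Literature.NumberTheory.EllipticCurves.bumpFriedbergHoffstein_exists_heegnerField_split_twist_simpleZero ∧
      Literature.NumberTheory.EllipticCurves.ModularForms.nonempty_modularParametrizationData ∧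
      WeierstrassCurve.bsdRHS_eq_of_isIsogenous ∧
      Literature.NumberTheory.EllipticCurves.ModularForms.mazur_not_dvd_maninConstant_of_odd ∧
      Literature.NumberTheory.EllipticCurves.ModularForms.abbesUllmo_not_dvd_maninConstant_of_not_dvd_level ∧
      Literature.NumberTheory.EllipticCurves.ModularForms.cesnavicius_not_two_dvd_maninConstant_of_two_dvd_level)
    (hMN : MatarNekovar2019.thm07_pow_dvd_card_sha_primary_of_certificate_of_irreducible)
    (hS2 : JetchevDivisibilityReadingS2) :
    Summit.BirchSwinnertonDyer.WAllExclAddGssAtThree ↔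
      (Gss2RankOneMcCallumCertificateAtThreeTower ∧
      (∀ (W : WeierstrassCurve ℚ) [W.IsElliptic] [W.IsGloballyMinimal], ¬ W.HasCM →
        Literature.NumberTheory.EllipticCurves.Rank1Residual.Addv W 3 → Summit.BirchSwinnertonDyer.Rank1Residual.Additive.SubGss W 3 →
        W.analyticRank = 1 → ¬ W.HasSurjectiveModNGaloisRep 3 →
        ∃ (N : ℕ) (_ : NeZero N) (K : Type) (_ : Field K) (_ : NumberField K)
          (Dt : Literature.NumberTheory.EllipticCurves.ModularForms.ModularParametrizationData W N)
          (H : Literature.NumberTheory.EllipticCurves.HeegnerDatum N (NumberField.discr K)) (ι : K →+* ℂ)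
          (P : (W.baseChange K).toAffine.Point) (Wd : WeierstrassCurve ℚ) (_ : Wd.IsElliptic) (_ : Wd.IsGloballyMinimal)
          (Cd : WeierstrassCurve.VariableChange ℚ) (M : ℕ),
          W.conductorNorm ℤ = N ∧ Literature.NumberTheory.EllipticCurves.IsImaginaryQuadratic K ∧ Odd (NumberField.discr K) ∧
          Literature.NumberTheory.EllipticCurves.SatisfiesHeegnerHypothesis N K ∧
          (W.quadraticTwist (NumberField.discr K : ℚ)).entireLFunction 1 ≠ 0 ∧
          WeierstrassCurve.Affine.Point.map ι.toRatAlgHom P = Literature.NumberTheory.EllipticCurves.ModularForms.heegnerPointComplex Dt H ∧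
          Cd • W.quadraticTwist (NumberField.discr K : ℚ) = Wd ∧
          (2 * M : ℤ) ≤ padicValNat 3 W.tamagawaProduct + padicValNat 3 Wd.tamagawaProduct + 2 * padicValRat 3 (Dt.c : ℚ) ∧
          Summit.BirchSwinnertonDyer.Rank1Residual.X11b.Three.Koly.CertificateAt Dt H.β ι 3 M) ∧
      (∀ (W : WeierstrassCurve ℚ) [W.IsElliptic] [W.IsGloballyMinimal], ¬ W.HasCM →
        Literature.NumberTheory.EllipticCurves.Rank1Residual.Addv W 3 →
        Summit.BirchSwinnertonDyer.Rank1Residual.Additive.SubGss W 3 → W.analyticRank = 0 →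
        ∃ (N : ℕ) (_ : NeZero N) (K : Type) (_ : Field K) (_ : NumberField K)
          (Dt : Literature.NumberTheory.EllipticCurves.ModularForms.ModularParametrizationData W N)
          (H : Literature.NumberTheory.EllipticCurves.HeegnerDatum N (NumberField.discr K)) (ι : K →+* ℂ)
          (P : (W.baseChange K).toAffine.Point) (Wd : WeierstrassCurve ℚ) (_ : Wd.IsElliptic) (_ : Wd.IsGloballyMinimal)
          (Cd : WeierstrassCurve.VariableChange ℚ) (M : ℕ),
          W.conductorNorm ℤ = N ∧ Literature.NumberTheory.EllipticCurves.IsImaginaryQuadratic K ∧ Odd (NumberField.discr K) ∧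
          Literature.NumberTheory.EllipticCurves.SatisfiesHeegnerHypothesis N K ∧
          (W.quadraticTwist (NumberField.discr K : ℚ)).analyticRank = 1 ∧
          WeierstrassCurve.Affine.Point.map ι.toRatAlgHom P =
            Literature.NumberTheory.EllipticCurves.ModularForms.heegnerPointComplex Dt H ∧
          Cd • W.quadraticTwist (NumberField.discr K : ℚ) = Wd ∧
          (2 * M : ℤ) ≤ padicValNat 3 W.tamagawaProduct + padicValNat 3 Wd.tamagawaProduct + 2 * padicValRat 3 (Dt.c : ℚ) ∧
          Summit.BirchSwinnertonDyer.Rank1Residual.X11b.Three.Koly.CertificateAt Dt H.β ι 3 M) ∧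
      LeafSigmaStarDivisibilityAtThreeOptimalOffRows ∧
      (∀ (W : WeierstrassCurve ℚ) [W.IsElliptic] [W.IsGloballyMinimal], ¬ W.HasCM →
        Literature.NumberTheory.EllipticCurves.Rank1Residual.Addv W 3 →
        Summit.BirchSwinnertonDyer.Rank1Residual.Additive.SubGss W 3 → W.analyticRank = 0 →
        ¬ W.HasSurjectiveModNGaloisRep 3 →
        ∃ (K : Type) (_ : Field K) (_ : NumberField K) (Wd : WeierstrassCurve ℚ) (_ : Wd.IsElliptic) (_ : Wd.IsGloballyMinimal),
          IsImaginaryQuadratic K ∧ Odd (NumberField.discr K) ∧ SatisfiesHeegnerHypothesis (W.conductorNorm ℤ) K ∧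
          (W.quadraticTwist (NumberField.discr K : ℚ)).entireLFunction 1 = 0 ∧
          deriv (W.quadraticTwist (NumberField.discr K : ℚ)).entireLFunction 1 ≠ 0 ∧
          (∃ C : VariableChange ℚ, C • W.quadraticTwist (NumberField.discr K : ℚ) = Wd) ∧ MissingLowerBoundAt Wd 3) ∧
      (∀ (W : WeierstrassCurve ℚ) [W.IsElliptic] [W.IsGloballyMinimal], ¬ W.HasCM →
        Literature.NumberTheory.EllipticCurves.Rank1Residual.Addv W 3 →
        Summit.BirchSwinnertonDyer.Rank1Residual.Additive.SubGss W 3 → W.analyticRank = 1 →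
        ∃ (K : Type) (_ : Field K) (_ : NumberField K) (Wd : WeierstrassCurve ℚ) (_ : Wd.IsElliptic) (_ : Wd.IsGloballyMinimal),
          IsImaginaryQuadratic K ∧ Odd (NumberField.discr K) ∧ SatisfiesHeegnerHypothesis (W.conductorNorm ℤ) K ∧
          (W.quadraticTwist (NumberField.discr K : ℚ)).entireLFunction 1 ≠ 0 ∧
          (∃ C : VariableChange ℚ, C • W.quadraticTwist (NumberField.discr K : ℚ) = Wd) ∧ MissingLowerBoundAt Wd 3)) := by
  obtain ⟨⟨hGZ, hKo, -, hGZK, hmod, hnf, -, hrec, -, h36⟩, hKatoT⟩ := id hpub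
  obtain ⟨-, -, -, -, hGZ73, hMNup, -, hFH, hmodP, -, hM, hAU, hC2⟩ := id hpubU
  have hBFH := hpub0.2.2.2.2.2.2.1
  constructor
  · ---------------------------------------------------------------- (⟹) tightness of every conjunct
    intro hleaf
    have halves : ∀ (V : WeierstrassCurve ℚ) [V.IsElliptic] [V.IsGloballyMinimal], ¬ V.HasCM → Addv V 3 → SubGss V 3 →
        V.analyticRank ≤ 1 → MissingLowerBoundAt V 3 ∧ MissingUpperBoundAt V 3 := by
      intro V _ _ hCMV haddV hsubV hrV
      haveI : Finite V.sha := (hGZK V hrV).2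
      exact Typed.lower_and_upper_of_missingPPartAt V 3 (Typed.missingPPartAt_of_bsdp V 3 (hleaf V hCMV haddV hsubV hrV))
    have hL1 : Gss2LowerAtThreeRankOne := fun V _ _ hCMV haddV hsubV hrV ↦ (halves V hCMV haddV hsubV (le_of_eq hrV)).1
    have hU1 : LeafRankOneUpperAtThree := fun V _ _ hCMV haddV hsubV hrV ↦ (halves V hCMV haddV hsubV (le_of_eq hrV)).2
    have hL0 : Gss2LowerAtThreeRankZero := fun V _ _ hCMV haddV hsubV hrV ↦
      (halves V hCMV haddV hsubV (by rw [hrV]; exact zero_le_one)).1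
    have hU0 : LeafRankZeroUpperAtThree := fun V _ _ hCMV haddV hsubV hrV ↦
      (halves V hCMV haddV hsubV (by rw [hrV]; exact zero_le_one)).2
    refine ⟨gss2RankOneMcCallumCertificateAtThreeTower_of_members hpub hmodP hMN hMNup hL1 hU1 hL0 hU0,
      certificates3Nn_of_members hpub hmodP hMN hMNup hL1 hU1 hL0 hU0,
      certificatesZero_of_members hpub hpub0 hMN hL1 hU1 hL0 hU0,
      RamifiedPairUpperBound.leafSigmaStarDivisibilityAtThreeOptimalOffRows_of_wAllExclAddGssAtThree hGZ hKo hGZK hmod hGZ73 hrec h36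
        hMN hM hAU hC2 hnf hleaf,
      fun W _ _ hCM hadd hsub hr _ ↦ RamifiedPairUpperBound.partnerLowerZero_of_wAllExclAddGssAtThree hmod hnf hBFH hGZK hleaf W hCM
        hadd hsub hr,
      fun W _ _ hCM hadd hsub hr ↦ RamifiedPairUpperBound.partnerLower_of_wAllExclAddGssAtThree hnf hFH hGZK hleaf W hCM hadd hsub hr⟩
  · ---------------------------------------------------------------- (⟸) the column with the tight inputs
    rintro ⟨hC, hC3, hC0, hSig, hPL1, hPL0⟩
    have hU03 := RamifiedPairUpperBound.leafRankZeroUpper_nonsplitRows_of_pubManin_of_divisibilityReading_of_sigmaStar_of_partnerLowerZeroNonsplit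
      hpub0 hS2 hSig hPL1
    have hL1 : Gss2LowerAtThreeRankOne :=
      gss2LowerAtThreeRankOne_of_pub_of_certificatesTower_of_structIrr_of_certificates3Nn_of_upper3Nn hpub hC hMN hC3 hU03
    have hU0 : LeafRankZeroUpperAtThree := RamifiedPairUpperBound.leafRankZeroUpperAtThree_of_katoTam_of_nonSurjThree hKatoT hGZK hmod hU03
    have hU1 : LeafRankOneUpperAtThree :=
      RamifiedPairUpperBound.leafRankOneUpperAtThree_of_pubManin_of_divisibilityReading_of_sigmaStar_of_partnerLower hpubU hS2 hSig hPL0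
    have hL0 : Gss2LowerAtThreeRankZero :=
      gss2LowerAtThreeRankZero_of_structIrr_of_certificatesZero_of_leafRankOneUpper hGZ hKo hGZK hmod hMN hC0 hU1
    exact closes hP hL1 hU1 hL0 hU0

end Summit.BirchSwinnertonDyer.BirchSwinnertonDyer.Theorems.RamifiedPairLowerBound

end
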